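/-
Origin: expansion seat `planner-pub-hodgecm-pv13-0`, handover 2026-08-18T03:40:31Z (`HOME/pub-hodgecm-pv13/lean/Pv13/CharsAssembly.lean`, md5 e978f500, 215 lines);
landed by the gen-5 packager in gate run 19 as `HodgeCM/PerL34/CharsAssembly.lean` (import ^import Pv13\.EulerProductProof\b→import HodgeCM.PerL34.EulerProduct ×1).
-/
/-
Origin: pub-hodgecm-pv13 (DAG-NODE PROVER #13), node N31 (parent) — PerL v5 Lemma 4.2(b) `lem:chars`,
tex ll. 529–532 (proof ll. 542–635 = sub-nodes N31a–N31h).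
Proposed place: `HodgeCM/PerL34/CharsAssembly.lean` (module `HodgeCM.PerL34.CharsAssembly`); on landing replace
`import Pv13.EulerProductProof` by the landed module name of that file (`HodgeCM.PerL34.EulerProduct`).
Imports: the LANDED carver typing `HodgeCM.PerL34.Chars` (N31_chars / N31_split / N31_of_charsDischarge), the
landed join file `HodgeCM.Automorphic.CharsOccJoin` (`Open_charsPkg`), and this seat's N31h file.
No new constants, nothing cited, nothing left unproved: an ASSEMBLY (kind L1 over the typed outputs of the cluster).
-/
import Summits.HodgeConjecture.HodgeCM.PerL34.Chars
import Summits.HodgeConjecture.HodgeCM.Automorphic.CharsOccJoin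
import Summits.HodgeConjecture.HodgeCM.PerL34.EulerProduct_2

set_option autoImplicit false

/-!
# N31 — PerL v5 Lemma 4.2(b) (tex ll. 529–532): assembly of the cluster N31a–N31h

VERBATIM (checked against `HOME/LEMMAS.md` §5 block N31, identical):

> 529: … \textup{(b)} If $(W_i,\mu_i)$ have the forced signs and infinity type of type
> 530: $\Psi_i$ (Definition~\ref{def:allowed}) and $\chi'_i$ has infinity type $e(\Psi_i)$ (Lemma~\ref{lem:arch}(a)),
>      then the theta
> 531: space $\pi_i:=\Theta^{W_i}_{\mu_i}(\chi'_i)$ is non-zero and every irreducible constituent $\sigma$ of its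
>      closure lies in
> 532: $\cA^{1,0}$ (and then $\Phi'(\sigma)=\Psi_i$ by Lemma~\ref{lem:allowed}(a)); i.e.\ $(W_i,\mu_i,\chi'_i)$ is
>      allowed.

## How the node is consumed, and the Def 3.2 dictionary

Downstream (Prop 3.6 / Thm 3.7, tex ll. 398–400, 441–442) the lemma is used in the form "every character `χ` of
`[T] = [U(W₁) × U(W₂)]` of archimedean type `w = (e(Ψ₁), e(Ψ₂))` arises from an allowed pair of type (12)", and
likewise for `T'`, type `w'`, (34).  That is exactly the frozen interface's reading: `TorusData.X` = the characters
of `[T]` of type `w` (Perl34.lean l. 183–185), `TorusData.allowed χ` = "`χ` arises from an allowed pair" (l. 190–195: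
the lines `W₁, W₂` and the splitting characters `μ₁μ₂ = μ_W` are FIXED, Def 3.2 ll. 277–279, so an allowed pair is a
pair of characters `(χ'₁, χ'₂)`, `χ = χ'₁ ⊠ χ'₂`, with BOTH data `(W_j, μ_j, χ'_j)` allowed), and the carver's
`N31_chars T := T.Open_chars` = "in every good context, every `χ : (T.t12 V c).X` and every `χ : (T.t34 V c).X` is
allowed" (`HodgeCM/PerL34/Chars.lean`).  DICTIONARY (Def 3.2, ll. 269–279 ↔ interface): for a pair character
`χ = χ'₁ ⊠ χ'₂` of type `w` (a character of the product `[U(1)] × [U(1)]` of compact abelian groups factors uniquely,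
and its archimedean type splits as `(e(Ψ₁), e(Ψ₂))`), "allowed" = for `j = 1, 2`: (α) `π_j = Θ^{W_j}_{μ_j}(χ'_j) ≠ 0`
AND (β) every irreducible constituent of the `L²`-closure of `π_j` lies in `𝒜^{1,0}`.  Lemma 4.2(b) is applied to EACH
of the two lines of the side; so per pair character the proof delivers TWO local-factor data (one per line, for
the `φ` chosen in the proof, ll. 608–631) — this is `SideOutputs` below.  Clause (α) for both lines is a THEOREM
(N31h (i): `LocalFactorDatum.theta_ne_zero`, `thetaSpace_ne_bot`); clause (β) for both lines, together with the
(semantic, because `X` is a bare type) factorisation `χ = χ'₁ ⊠ χ'₂`, is the field `allowed_of_pair` — the node's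
residual, = N31h (ii) (GAPS.md `pv13/N31h(ii)`) read through Def 3.2.  FAITHFULNESS NOTE on the prior skeleton:
`Perl34.C4.CharsDischarge` carries ONE Rallis chain and ONE theta vector per pair character and the bridge
`θvec χ ≠ 0 → allowed χ`; the tex needs non-vanishing on BOTH lines.  Here the bridge is DERIVED from the two-line
form: the second line's non-vanishing is a theorem, so feeding `CharsDischarge` with the first line's chain loses
nothing (`SideOutputs.charsDischarge`).

## What is proved (kernel, no residual beyond the displayed fields)

`SideOutputs.allowed_all` (Lemma 4.2(b) for one torus side, from the side's outputs), `SideOutputs.charsDischarge`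
(the prior/carver package), `ClusterOutputs T` (both sides in every good context), `N31_split_of_cluster :
ClusterOutputs T → N31_split T`, `N31_of_cluster : ClusterOutputs T → N31_chars T`, `open_chars_of_cluster :
ClusterOutputs T → T.Open_chars` (= fact A9 of the realisation interface), `open_charsPkg_of_cluster` (the finer
form consumed by `CharsOccJoin`).  The parenthetical "(and then `Φ'(σ)=Ψ_i` by Lemma 3.3(a))" is node N12 and is
not part of this node's content.
-/

namespace HodgeCM
namespace PerL34

open HodgeCM.Prior.Perl34File
open EulerProduct

universe u

section Side

variable {H HG CG G SK SigIdx SigIdxG : Type*}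
variable [NormedAddCommGroup H] [InnerProductSpace ℂ H] [CompleteSpace H]
variable [NormedAddCommGroup HG] [InnerProductSpace ℂ HG] [CompleteSpace HG]
variable [NormedAddCommGroup CG] [NormedSpace ℂ CG]
variable [Group G] [TopologicalSpace G] [TopologicalSpace SK]
variable {C : Perl34.IsolationCore H HG CG G SK SigIdx SigIdxG}

/-- **Outputs of the proof of Lemma 4.2(b) for ONE torus side** (`T = U(W₁) × U(W₂)` resp. `T'`), indexed by the
places `Pl` of `L₀`: for every character `χ = χ'₁ ⊠ χ'₂` of `[T]` of the side's archimedean type, the local-factor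
datum of the proof (ll. 588–631: Rallis identity, local factors, unramified values — nodes N31d–N31g) for the
FIRST line and for the SECOND line, and the Def 3.2 bridge: non-vanishing of both theta lifts (clause (α), which
N31h (i) PROVES from the data) implies — via clause (β) = N31h (ii), the residual — that `χ` arises from an
allowed pair. -/
structure SideOutputs (D : Perl34.TorusData C) (Pl : Type) where
  /-- the datum for the line `W₁` (resp. `W₃`) and the character `χ'₁` (resp. `χ'₃`) of the pair `χ` -/
  fst : D.X → LocalFactorDatum Pl HG
  /-- the datum for the line `W₂` (resp. `W₄`) and the character `χ'₂` (resp. `χ'₄`) of the pair `χ` -/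
  snd : D.X → LocalFactorDatum Pl HG
  /-- RESIDUAL (N31h (ii) through Def 3.2, ll. 632–635 with 269–279): if both theta lifts are nonzero then
  `χ = χ'₁ ⊠ χ'₂` arises from an allowed pair (the constituent clause (β) for both lines is INSIDE this field). -/
  allowed_of_pair : ∀ χ : D.X, (fst χ).theta ≠ 0 → (snd χ).theta ≠ 0 → D.allowed χ

namespace SideOutputs

variable {D : Perl34.TorusData C} {Pl : Type}

/-- Clause (α) of Def 3.2 for BOTH lines is a theorem (N31h (i)): both lifts are nonzero. -/
theorem theta_ne_zero_both (S : SideOutputs D Pl) (χ : D.X) :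
    (S.fst χ).theta ≠ 0 ∧ (S.snd χ).theta ≠ 0 :=
  ⟨(S.fst χ).theta_ne_zero, (S.snd χ).theta_ne_zero⟩

/-- Both theta SPACES `π₁, π₂` (spans of the lifts) are nonzero, and so are their closures (l. 531 "the theta
space … is non-zero", for both lines of the side). -/
theorem thetaSpace_closure_ne_bot_both (S : SideOutputs D Pl) (χ : D.X) :
    (Submodule.span ℂ (S.fst χ).Theta).topologicalClosure ≠ ⊥ ∧
      (Submodule.span ℂ (S.snd χ).Theta).topologicalClosure ≠ ⊥ :=
  ⟨(S.fst χ).thetaSpace_closure_ne_bot, (S.snd χ).thetaSpace_closure_ne_bot⟩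

/-- **Lemma 4.2(b) for the side, in the consumed form**: every character of `[T]` of type `w` arises from an
allowed pair.  PROVED from the side's outputs (the only non-derived input being the residual field). -/
theorem allowed_all (S : SideOutputs D Pl) : ∀ χ : D.X, D.allowed χ :=
  fun χ => S.allowed_of_pair χ (S.fst χ).theta_ne_zero (S.snd χ).theta_ne_zero

/-- The one-vector constituent half of N31h for the first line, DERIVED from the two-line bridge (the second
line's non-vanishing being a theorem). -/
theorem constituentHalf_fst (S : SideOutputs D Pl) : ConstituentHalf D S.fst :=
  fun χ h₁ => S.allowed_of_pair χ h₁ (S.snd χ).theta_ne_zero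

/-- **The prior / carver package for the side** (`Perl34.C4.CharsDischarge`, = the N31 second layer's datum):
Rallis chain and theta vector of the first line, `AX7_tail` and `innerSelf_eq` theorems (N31h (i)), bridge derived. -/
noncomputable def charsDischarge (S : SideOutputs D Pl) : Perl34.C4.CharsDischarge D Pl :=
  charsDischargeOf D S.fst S.constituentHalf_fst

/-- Consistency: the package's route (`CharsDischarge.H_chars`) and the direct route agree (both are proofs of
the same proposition; recorded so that either may be quoted). -/
theorem allowed_all_eq_H_chars (S : SideOutputs D Pl) : S.allowed_all = S.charsDischarge.H_chars := rfl

end SideOutputs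

end Side


section CharacterFactorisation

/-! ### The Def 3.2 dictionary's one checkable ingredient: characters of a product torus factor

"`χ = χ'₁ ⊠ χ'₂`": a (unitary, continuous) character of `[T] = [U(W₁)] × [U(W₂)]` is, in exactly one way, the
external product of characters of the two factors (used silently at ll. 345–346, 398–400 and in Def 3.2's "pair";
the archimedean type then splits componentwise).  Kernel-proved for an arbitrary product of groups with values in
a commutative group, with the continuity upgrade. -/

variable {A B M : Type*} [Group A] [Group B] [CommGroup M]

/-- Existence and uniqueness of the factorisation `χ(a,b) = χ₁(a) · χ₂(b)`. -/
theorem MonoidHom.existsUnique_prod_factor (χ : A × B →* M) :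
    ∃! p : (A →* M) × (B →* M), ∀ a b, χ (a, b) = p.1 a * p.2 b := by
  refine ⟨(χ.comp (MonoidHom.inl A B), χ.comp (MonoidHom.inr A B)), ?_, ?_⟩
  · intro a b
    have : ((a, b) : A × B) = (a, 1) * (1, b) := by simp
    rw [this, map_mul]
    rfl
  · rintro ⟨p₁, p₂⟩ hp
    have h₁ : ∀ a, p₁ a = χ (a, 1) := fun a => by simpa using (hp a 1).symm
    have h₂ : ∀ b, p₂ b = χ (1, b) := fun b => by simpa using (hp 1 b).symm
    ext x
    · simpa using h₁ x
    · simpa using h₂ x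

/-- The factors are the restrictions `χ(·,1)` and `χ(1,·)`. -/
theorem MonoidHom.prod_factor_apply (χ : A × B →* M) (a : A) (b : B) :
    χ (a, b) = χ.comp (MonoidHom.inl A B) a * χ.comp (MonoidHom.inr A B) b := by
  have : ((a, b) : A × B) = (a, 1) * (1, b) := by simp
  rw [this, map_mul]
  rfl

variable [TopologicalSpace A] [TopologicalSpace B] [TopologicalSpace M]

/-- Continuity upgrade: the factors of a continuous character are continuous. -/
theorem MonoidHom.continuous_prod_factors (χ : A × B →* M) (hχ : Continuous χ) :
    Continuous (χ.comp (MonoidHom.inl A B)) ∧ Continuous (χ.comp (MonoidHom.inr A B)) :=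
  ⟨hχ.comp (Continuous.prodMk continuous_id continuous_const),
    hχ.comp (Continuous.prodMk continuous_const continuous_id)⟩

end CharacterFactorisation

section Model

variable {U : Universe} (T : U.ThetaModel)

/-- **Outputs of the N31 cluster for the model**: in every good context (forced signs and infinity types —
the HYPOTHESES of Lemma 4.2(b), `ThetaModel.GoodCtx`), for some index type of places, the side outputs for the
(12) side and for the (34) side. -/
def ClusterOutputs : Prop :=
  ∀ {L : CMField} {ι₁ : L →+* ℂ} (V : HermSpace3 L ι₁) (c : SeesawCtx L), T.GoodCtx ι₁ c →
    ∃ Pl : Type, Nonempty (SideOutputs (T.t12 V c) Pl) ∧ Nonempty (SideOutputs (T.t34 V c) Pl)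

/-- **N31 second layer from the cluster**: the carver's `N31_split` (a `CharsDischarge` package on both sides). -/
theorem N31_split_of_cluster (h : ClusterOutputs T) : N31_split T := by
  intro L ι₁ V c hc
  obtain ⟨Pl, ⟨S12⟩, ⟨S34⟩⟩ := h V c hc
  exact ⟨Pl, ⟨S12.charsDischarge⟩, ⟨S34.charsDischarge⟩⟩

/-- **N31 from the cluster** (Lemma 4.2(b) as typed by the carver, `N31_chars T`). -/
theorem N31_of_cluster (h : ClusterOutputs T) : N31_chars T :=
  N31_of_charsDischarge T (N31_split_of_cluster T h)

/-- The same, by the direct route (no detour through the prior package): fact **A9** `Open_chars` of the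
realisation interface. -/
theorem open_chars_of_cluster (h : ClusterOutputs T) : T.Open_chars := by
  intro L ι₁ V c hc
  obtain ⟨Pl, ⟨S12⟩, ⟨S34⟩⟩ := h V c hc
  exact ⟨S12.allowed_all, S34.allowed_all⟩

/-- The finer input `Open_charsPkg` of `HodgeCM.Automorphic.CharsOccJoin` (one package per side, each with
its own index type). -/
theorem open_charsPkg_of_cluster (h : ClusterOutputs T) : T.Open_charsPkg := by
  intro L ι₁ V c hc
  obtain ⟨Pl, ⟨S12⟩, ⟨S34⟩⟩ := h V c hc
  exact ⟨⟨Pl, ⟨S12.charsDischarge⟩⟩, ⟨Pl, ⟨S34.charsDischarge⟩⟩⟩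

end Model

end PerL34
end HodgeCM
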